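import Mathlib.Probability.Distributions.Gaussian.IsGaussianProcess.Independence
import Literature.Probability.LatticeModels.CableGFFLevelSets
import Literature.Probability.LatticeModels.DirichletGreenFunction
import HarnessLib

/-!
# The domain Markov property of the discrete Gaussian free field of `ℤ^d` (`d ≥ 3`)

Topic `Literature/Probability/LatticeModels`. For a version `g` of the discrete GFF of `ℤ^d`
(`IsDiscreteGFF P g`, `CableGFFLevelSets.lean`: a centred Gaussian process with covariance
`G(x, y) = latticeGreen (x - y) / 2 = (-L)⁻¹(x, y)`, unit conductances) and a finite set `K` with
outer boundary `∂K = outerBoundary (zdGraph d) K`, we prove the DOMAIN MARKOV PROPERTY in the form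
used by sign-flip arguments, on top of the tree's Dirichlet Green function `dirichletGreen K` and
Poisson kernel `poissonKernel K` (`DirichletGreenFunction.lean`):

* glue (deterministic): `sum_poissonKernel_mul_eq_sum_dirichletGreen_mul`
  (`∑_{s ∈ ∂K} H_K(u,s) φ_s = ∑_{v ∈ K} G_K(u,v) ∑_{s ∼ v} φ_s`) and
  **`half_latticeGreen_eq_dirichletGreen_add_sum`** (`d ≥ 3`):
  `G(u,t) = G_K(u,t) + ∑_{s ∈ ∂K} H_K(u,s) G(s,t)` for `u ∈ K`, from Green's representation
  formula (`green_representation`) and the Poisson equation `(-Δ)(latticeGreen/2) = δ₀`;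
* basic API of `IsDiscreteGFF` (`hasGaussianLaw`, `memLp_two`, `integrable`, `aemeasurable`,
  `aemeasurable_pi`, `covariance_eq : Cov(φ_x, φ_y) = latticeGreen (x - y) / 2`);
* `markovRemainder K g u = φ_u - ∑_{s ∈ ∂K} H_K(u, s) φ_s` (`u ∈ K`), the field minus the harmonic
  extension of its boundary values; `isGaussianProcess_sumElim` — `(Z, φ|_{∂K})` is a Gaussian
  process (linear image of finitely many coordinates);
* `covariance_markovRemainder_eval : Cov(Z_u, φ_t) = G_K(u, t)` (vanishing for `t ∉ K`, in
  particular on `∂K`: `covariance_markovRemainder_boundary`), `covariance_markovRemainder :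
  Cov(Z_u, Z_v) = G_K(u, v)`, `integral_markovRemainder : E Z_u = 0`;
* **`indepFun_markovRemainder_boundary`** — `Z ⊥ φ|_{∂K}` (jointly Gaussian and uncorrelated,
  Mathlib's `IsGaussianProcess.indepFun_of_covariance_eq_zero`): conditionally on `φ|_{∂K}` the
  field on `K` is the harmonic extension plus an independent centred Gaussian vector with
  covariance `G_K` (Friedli–Velenik 2017, Thm. 8.21 / Prop. 8.7; Lupu 2016, §1);
  `hasGaussianLaw_markovRemainder`.

Only the covariance structure of `g` is used (no densities): the Markov property of the
infinite-volume field is DERIVED from `E[φ_x φ_y] = G(x, y)` and `(-Δ) G = δ`. The sign-flip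
consequence (Lupu's symmetry of bounded clusters) is in `DiscreteGFFFlip.lean`.

References: S. Friedli, Y. Velenik, *Statistical Mechanics of Lattice Systems* (2017), Ch. 8
(bib key `FriedliVelenik2017`); T. Lupu, Ann. Probab. 44 (2016), arXiv:1402.0298 (`Lupu2016`);
G. F. Lawler, *Intersections of Random Walks* (1991), §1.4–1.5 (`Lawler1991`).
-/

noncomputable section

namespace Literature.Probability.LatticeModels

open _root_.MeasureTheory _root_.ProbabilityTheory Finset Matrix

variable {d : ℕ}

/-! ### Glue: the whole-space Green function against the Dirichlet Green function of `K` -/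

/-- For `v ∈ K`, the neighbours of `v` split into those in `K` and those in the outer boundary
`∂K`. [folklore] -/
theorem neighborFinset_eq_filter_union_outerBoundary {K : Finset (Site d)} {v : Site d} (hv : v ∈ K) :
    (zdGraph d).neighborFinset v =
      K.filter (fun y => (zdGraph d).Adj v y) ∪
        (outerBoundary (zdGraph d) K).filter (fun y => (zdGraph d).Adj v y) := by
  ext y
  simp only [SimpleGraph.mem_neighborFinset, mem_union, mem_filter, mem_outerBoundary_iff]
  constructor
  · intro h
    by_cases hy : y ∈ K
    · exact Or.inl ⟨hy, h⟩
    · exact Or.inr ⟨⟨hy, v, hv, h.symm⟩, h⟩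
  · rintro (⟨-, h⟩ | ⟨-, h⟩) <;> exact h

/-- Splitting a sum over the neighbours of `v ∈ K` into the part in `K` and the part in `∂K`.
[folklore] -/
theorem sum_neighborFinset_eq_sum_filter_add {K : Finset (Site d)} {v : Site d} (hv : v ∈ K)
    (φ : Site d → ℝ) :
    ∑ y ∈ (zdGraph d).neighborFinset v, φ y =
      (∑ w ∈ K, if (zdGraph d).Adj v w then φ w else 0) +
        ∑ s ∈ outerBoundary (zdGraph d) K, if (zdGraph d).Adj v s then φ s else 0 := by
  rw [neighborFinset_eq_filter_union_outerBoundary hv, Finset.sum_union, Finset.sum_filter,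
    Finset.sum_filter]
  rw [Finset.disjoint_left]
  intro y hy hy'
  exact (mem_outerBoundary_iff.1 (mem_filter.1 hy').1).1 (mem_filter.1 hy).1

/-- **Last-exit decomposition against boundary data**: for `u ∈ ℤ^d` and any `φ`,
`∑_{s ∈ ∂K} H_K(u, s) φ s = ∑_{v ∈ K} G_K(u, v) ∑_{s ∈ ∂K, s ∼ v} φ s` (the Poisson kernel is the
Green potential of the boundary adjacency). [cite: Lawler1991, §1.4, p. 21] -/
theorem sum_poissonKernel_mul_eq_sum_dirichletGreen_mul (K : Finset (Site d)) (u : Site d)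
    (φ : Site d → ℝ) :
    ∑ s ∈ outerBoundary (zdGraph d) K, poissonKernel K u s * φ s =
      ∑ v ∈ K, dirichletGreen K u v *
        ∑ s ∈ outerBoundary (zdGraph d) K, if (zdGraph d).Adj v s then φ s else 0 := by
  classical
  set F : Site d → ℝ := fun z => if z ∈ outerBoundary (zdGraph d) K then φ z else 0 with hF
  have hFK : ∀ z ∈ K, F z = 0 := fun z hz => by
    rw [hF]
    simp only
    rw [if_neg]
    exact fun h => (mem_outerBoundary_iff.1 h).1 hz
  have key := sum_mul_sum_neighborFinset_eq K (g := dirichletGreen K u)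
    (fun y hy => dirichletGreen_of_not_mem_right K u hy) F
  -- left-hand side of `key`
  have hL : ∑ y ∈ K, dirichletGreen K u y * ∑ z ∈ (zdGraph d).neighborFinset y, F z =
      ∑ v ∈ K, dirichletGreen K u v *
        ∑ s ∈ outerBoundary (zdGraph d) K, if (zdGraph d).Adj v s then φ s else 0 := by
    refine Finset.sum_congr rfl fun v hv => ?_
    congr 1
    rw [sum_neighborFinset_eq_sum_filter_add hv F]
    have h1 : (∑ w ∈ K, if (zdGraph d).Adj v w then F w else 0) = 0 :=
      Finset.sum_eq_zero fun w hw => by rw [hFK w hw, ite_self]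
    rw [h1, zero_add]
    refine Finset.sum_congr rfl fun s hs => ?_
    simp only [hF, hs, if_true]
  -- right-hand side of `key`
  have hR : ∑ z ∈ K ∪ outerBoundary (zdGraph d) K,
      F z * ∑ y ∈ (zdGraph d).neighborFinset z, dirichletGreen K u y =
      ∑ s ∈ outerBoundary (zdGraph d) K, poissonKernel K u s * φ s := by
    rw [Finset.sum_union (Finset.disjoint_left.2 fun z hz hz' => (mem_outerBoundary_iff.1 hz').1 hz)]
    have h1 : ∑ z ∈ K, F z * ∑ y ∈ (zdGraph d).neighborFinset z, dirichletGreen K u y = 0 :=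
      Finset.sum_eq_zero fun z hz => by rw [hFK z hz, zero_mul]
    rw [h1, zero_add]
    refine Finset.sum_congr rfl fun s hs => ?_
    rw [poissonKernel, if_neg (mem_outerBoundary_iff.1 hs).1, mul_comm]
    simp only [hF, hs, if_true]
  rw [← hR, ← key, hL]

/-- **Decomposition of the lattice Green function of `ℤ^d` (`d ≥ 3`) on a finite set**: for
`u ∈ K` and any `t`, with `G = latticeGreen / 2` (`(-Δ) G = δ`),
`G(u, t) = G_K(u, t) + ∑_{s ∈ ∂K} H_K(u, s) G(s, t)` — `G(·, t)` minus its harmonic extension from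
`∂K` is the Dirichlet Green function (Green's representation formula applied to `G(·, t)`;
Lawler–Limic 2010, Prop. 4.6.2 (b)). [cite: Lawler1991, §1.5, p. 29] -/
theorem half_latticeGreen_eq_dirichletGreen_add_sum (hd : 3 ≤ d) (K : Finset (Site d)) {u : Site d}
    (hu : u ∈ K) (t : Site d) :
    latticeGreen (u - t) / 2 =
      dirichletGreen K u t +
        ∑ s ∈ outerBoundary (zdGraph d) K, poissonKernel K u s * (latticeGreen (s - t) / 2) := by
  have hd0 : 0 < d := by omega
  have h := green_representation hd0 K (fun y : Site d => latticeGreen (y - t) / 2) hu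
  -- Poisson equation in the first variable: `-Δ_y G(y - t) = δ_{y t}`
  have hP : ∀ y : Site d, -latticeLaplacianZd (fun y : Site d => latticeGreen (y - t) / 2) y =
      if y = t then 1 else 0 := fun y => by
    have h1 := latticeLaplacianZd_comp_add (fun z => latticeGreen z / 2) (-t) y
    simp only [← sub_eq_add_neg] at h1
    rw [h1, latticeLaplacianZd_half_latticeGreen d hd, neg_neg]
    simp only [sub_eq_zero]
  simp only [hP, mul_ite, mul_one, mul_zero, Finset.sum_ite_eq'] at h
  rw [h]
  congr 1
  by_cases ht : t ∈ K
  · rw [if_pos ht]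
  · rw [if_neg ht, dirichletGreen_of_not_mem_right K u ht]


variable {Ω : Type*} [MeasurableSpace Ω] {P : Measure Ω} {g : Site d → Ω → ℝ}

namespace IsDiscreteGFF

/-- A discrete GFF is a Gaussian process. [cite: Lupu2016, §1 (arXiv numbering)] -/
theorem isGaussianProcess (hg : IsDiscreteGFF P g) : IsGaussianProcess g P := hg.1

/-- A discrete GFF is centred. [cite: Lupu2016, §1 (arXiv numbering)] -/
theorem integral_eq_zero (hg : IsDiscreteGFF P g) (x : Site d) : ∫ ω, g x ω ∂P = 0 := hg.2.1 x

/-- The two-point function of the discrete GFF is the Green function `latticeGreen / 2`.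
[cite: Lupu2016, §1 (arXiv numbering)] -/
theorem integral_mul_eq (hg : IsDiscreteGFF P g) (x y : Site d) :
    ∫ ω, g x ω * g y ω ∂P = latticeGreen (x - y) / 2 := hg.2.2 x y

/-- The underlying measure of a discrete GFF is a probability measure. [folklore] -/
theorem isProbabilityMeasure (hg : IsDiscreteGFF P g) : IsProbabilityMeasure P :=
  hg.1.isProbabilityMeasure

/-- Each coordinate of the discrete GFF is a Gaussian variable. [folklore] -/
theorem hasGaussianLaw (hg : IsDiscreteGFF P g) (x : Site d) : HasGaussianLaw (g x) P :=
  hg.1.hasGaussianLaw_eval x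

/-- Each coordinate of the discrete GFF is square integrable. [folklore] -/
theorem memLp_two (hg : IsDiscreteGFF P g) (x : Site d) : MemLp (g x) 2 P :=
  (hg.hasGaussianLaw x).memLp_two

/-- Each coordinate of the discrete GFF is integrable. [folklore] -/
theorem integrable (hg : IsDiscreteGFF P g) (x : Site d) : Integrable (g x) P :=
  (hg.hasGaussianLaw x).integrable

/-- Each coordinate of the discrete GFF is a.e.-measurable. [folklore] -/
theorem aemeasurable (hg : IsDiscreteGFF P g) (x : Site d) : AEMeasurable (g x) P :=
  (hg.hasGaussianLaw x).aemeasurable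

/-- The whole field, as a random element of `ℤ^d → ℝ`, is a.e.-measurable (countably many
coordinates). [folklore] -/
theorem aemeasurable_pi (hg : IsDiscreteGFF P g) : AEMeasurable (fun ω y => g y ω) P :=
  aemeasurable_pi_lambda _ hg.aemeasurable

/-- The covariance of the discrete GFF: `Cov(φ_x, φ_y) = G(x, y) = latticeGreen (x - y) / 2`.
[cite: Lupu2016, §1 (arXiv numbering)] -/
theorem covariance_eq (hg : IsDiscreteGFF P g) (x y : Site d) :
    cov[g x, g y; P] = latticeGreen (x - y) / 2 := by
  have := hg.isProbabilityMeasure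
  rw [covariance_eq_sub (hg.memLp_two x) (hg.memLp_two y), hg.integral_eq_zero, zero_mul,
    sub_zero]
  exact hg.integral_mul_eq x y

end IsDiscreteGFF

/-! ### The Markov decomposition on a finite set -/

/-- The **Markov remainder** of the field on the finite set `K`: for `u ∈ K`,
`Z_u = φ_u - ∑_{s ∈ ∂K} H_K(u, s) φ_s`, the field minus the harmonic extension of its values on
the outer boundary `∂K`. By the domain Markov property it is a Dirichlet GFF on `K` independent
of the field off `K`. (Lupu 2016, §1; Friedli–Velenik 2017, Thm. 8.21 / Prop. 8.7.) [folklore] -/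
def markovRemainder (K : Finset (Site d)) (g : Site d → Ω → ℝ) (u : K) (ω : Ω) : ℝ :=
  g u ω - ∑ s ∈ outerBoundary (zdGraph d) K, poissonKernel K u s * g s ω

namespace IsDiscreteGFF

variable (K : Finset (Site d))

/-- The Markov remainder on `K` together with the field on `∂K` is a Gaussian process (a linear
image of finitely many coordinates of the GFF). [folklore] -/
theorem isGaussianProcess_sumElim (hg : IsDiscreteGFF P g) :
    IsGaussianProcess (Sum.elim (fun u : K => markovRemainder K g u)
      (fun s : outerBoundary (zdGraph d) K => g s)) P := by
  classical
  refine hg.1.of_isGaussianProcess fun i => ?_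
  rcases i with u | s
  · refine ⟨insert (u : Site d) (outerBoundary (zdGraph d) K),
      { toFun := fun x => x ⟨u, mem_insert_self _ _⟩ -
          ∑ s ∈ (outerBoundary (zdGraph d) K).attach,
            poissonKernel K u s * x ⟨s, mem_insert_of_mem s.2⟩
        map_add' := fun x y => by
          simp only [Pi.add_apply, mul_add, Finset.sum_add_distrib]; ring
        map_smul' := fun c x => by
          simp only [Pi.smul_apply, smul_eq_mul, RingHom.id_apply]
          rw [mul_sub, Finset.mul_sum]
          congr 1
          refine Finset.sum_congr rfl fun s _ => ?_; ring }, fun ω => ?_⟩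
    simp only [Sum.elim_inl, markovRemainder, ContinuousLinearMap.coe_mk', LinearMap.coe_mk,
      AddHom.coe_mk, Finset.restrict_def]
    congr 1
    exact (Finset.sum_attach _ fun s => poissonKernel K u s * g s ω).symm
  · refine ⟨{(s : Site d)},
      { toFun := fun x => x ⟨s, mem_singleton_self _⟩
        map_add' := fun x y => by simp
        map_smul' := fun c x => by simp }, fun ω => ?_⟩
    simp [Finset.restrict_def]

/-- Covariance of the Markov remainder with the field: `Cov(Z_u, φ_t) = [t ∈ K] G_K(u, t)`
(`d ≥ 3`); in particular it vanishes for `t ∉ K`. [folklore] -/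
theorem covariance_markovRemainder_eval (hg : IsDiscreteGFF P g) (hd : 3 ≤ d) (u : K) (t : Site d) :
    cov[markovRemainder K g u, g t; P] = dirichletGreen K u t := by
  have := hg.isProbabilityMeasure
  have hsum : MemLp (fun ω => ∑ s ∈ outerBoundary (zdGraph d) K, poissonKernel K u s * g s ω) 2 P :=
    memLp_finsetSum _ fun s _ => (hg.memLp_two s).const_mul _
  unfold markovRemainder
  rw [covariance_fun_sub_left (hg.memLp_two u) hsum (hg.memLp_two t),
    covariance_fun_sum_left' (fun s _ => (hg.memLp_two s).const_mul _) (hg.memLp_two t)]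
  simp only [covariance_const_mul_left, hg.covariance_eq]
  have h := half_latticeGreen_eq_dirichletGreen_add_sum hd K u.2 t
  rw [h]
  ring

/-- The Markov remainder is uncorrelated with the field on the outer boundary. [folklore] -/
theorem covariance_markovRemainder_boundary (hg : IsDiscreteGFF P g) (hd : 3 ≤ d) (u : K)
    (s : outerBoundary (zdGraph d) K) :
    cov[markovRemainder K g u, g s; P] = 0 := by
  rw [hg.covariance_markovRemainder_eval K hd u s,
    dirichletGreen_of_not_mem_right K _ (mem_outerBoundary_iff.1 s.2).1]

/-- The covariance of the Markov remainder is the Green function of `K`: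
`Cov(Z_u, Z_v) = G_K(u, v)`. [folklore] -/
theorem covariance_markovRemainder (hg : IsDiscreteGFF P g) (hd : 3 ≤ d) (u v : K) :
    cov[markovRemainder K g u, markovRemainder K g v; P] = dirichletGreen K u v := by
  have := hg.isProbabilityMeasure
  have hZ : MemLp (markovRemainder K g u) 2 P :=
    (hg.memLp_two u).sub (memLp_finsetSum _ fun s _ => (hg.memLp_two s).const_mul _)
  have hsum : MemLp (fun ω => ∑ s ∈ outerBoundary (zdGraph d) K, poissonKernel K v s * g s ω) 2 P :=
    memLp_finsetSum _ fun s _ => (hg.memLp_two s).const_mul _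
  conv_lhs => rw [show markovRemainder K g v = fun ω => g v ω -
    ∑ s ∈ outerBoundary (zdGraph d) K, poissonKernel K v s * g s ω from rfl]
  rw [covariance_fun_sub_right hZ (hg.memLp_two v) hsum,
    covariance_fun_sum_right' (fun s _ => (hg.memLp_two s).const_mul _) hZ]
  simp only [covariance_const_mul_right]
  rw [hg.covariance_markovRemainder_eval K hd u v]
  have h0 : ∀ s ∈ outerBoundary (zdGraph d) K,
      poissonKernel K v s * cov[markovRemainder K g u, g s; P] = 0 := fun s hs => by
    rw [hg.covariance_markovRemainder_eval K hd u s,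
      dirichletGreen_of_not_mem_right K _ (mem_outerBoundary_iff.1 hs).1, mul_zero]
  rw [Finset.sum_eq_zero h0, sub_zero]

/-- The Markov remainder is centred. [folklore] -/
theorem integral_markovRemainder (hg : IsDiscreteGFF P g) (u : K) :
    ∫ ω, markovRemainder K g u ω ∂P = 0 := by
  unfold markovRemainder
  rw [integral_sub (hg.integrable u) (integrable_finsetSum _ fun s _ => (hg.integrable s).const_mul _),
    integral_finsetSum _ fun s _ => (hg.integrable s).const_mul _]
  simp [integral_const_mul, hg.integral_eq_zero]

/-- **Domain Markov property (independence form).** The Markov remainder on `K` is independent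
of the field on the outer boundary `∂K` (jointly Gaussian and uncorrelated). (Friedli–Velenik 2017,
Thm. 8.21; Lupu 2016, §1.) [folklore] -/
theorem indepFun_markovRemainder_boundary (hg : IsDiscreteGFF P g) (hd : 3 ≤ d) :
    IndepFun (fun ω (u : K) => markovRemainder K g u ω)
      (fun ω (s : outerBoundary (zdGraph d) K) => g s ω) P :=
  (hg.isGaussianProcess_sumElim K).indepFun_of_covariance_eq_zero
    (fun u => ((hg.isGaussianProcess_sumElim K).hasGaussianLaw_eval (Sum.inl u)).aemeasurable)
    (fun s => hg.aemeasurable s) (fun u s => hg.covariance_markovRemainder_boundary K hd u s)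

/-- The Markov remainder is a Gaussian vector. [folklore] -/
theorem hasGaussianLaw_markovRemainder (hg : IsDiscreteGFF P g) :
    HasGaussianLaw (fun ω (u : K) => markovRemainder K g u ω) P := by
  classical
  have h := (hg.isGaussianProcess_sumElim K).hasGaussianLaw Finset.univ
  let L : ((↥(univ : Finset (↥K ⊕ ↥(outerBoundary (zdGraph d) K)))) → ℝ) →L[ℝ] (↥K → ℝ) :=
    { toFun := fun x u => x ⟨Sum.inl u, Finset.mem_univ _⟩
      map_add' := fun x y => by funext u; simp
      map_smul' := fun c x => by funext u; simp }
  have := h.map L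
  refine this.congr (Filter.Eventually.of_forall fun ω => ?_)
  funext u
  simp [L, Finset.restrict_def]

end IsDiscreteGFF

end Literature.Probability.LatticeModels

end
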